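import Mathlib
import HarnessLib
import Literature.MathematicalPhysics.QuantumLattice.DWaveSourceProofs
import Summits.HubbardSuperconductivity.HubbardSuperconductivity.Theorems.ThermalWedgeTwSeededEnsembleEquivalenceRRectangles
import Summits.HubbardSuperconductivity.HubbardSuperconductivity.Theorems.WeakCouplingBCSWcbcsBcsConstructionTorusBoxComparison

/-!
# Route `ThermalWedge`, crux `TwSeededEnsembleEquivalenceR` (stmt-HubbardSuperconductivity-15581):
# the d-wave-sourced torus versus the free-boundary box — operator-norm comparison

Support file (`--supports stmt-HubbardSuperconductivity-15581`; no definition; the route file is NOT imported).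
Sixth layer of the infrastructure for the registered stub `stub_sourcedPressureLimit`. On the common vertex set
`FermionTorus 2 L` we compare the route's `dWaveSourceTorus L U μ h = (H(1,U) - μN)_torus - h(Δ_d + Δ_dᴴ)` with the
FREE-BOUNDARY pair-sourced box `H_box = (H(1,U) - μN)_box - h(P + Pᴴ)`, `P = Σ_{(x,y)} ĝ_d(y - x)/√2 · b_{xy}`
(integer coordinates, no wrap-around):

* the d-wave kernel `ω_d = ĝ_d/√2` is a nearest-neighbour kernel with `‖ω_d‖ ≤ 1` (`twR_dWaveKernel_norm_le/adj`),
  and `Z_β(H_box) = Z_β` of the `L × L` rectangle of `…RRectangles.lean` (`twR_box_partitionFn_eq_rect`, tree `relabel`);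
* `Δ_g = Σ_{(x,y)} A_g(x,y) b_{xy}` with `A_g(x,y) = Σ_{e ∈ {0,±e₁,±e₂}} 1[y = x + e (mod L)] g(e)/√2`
  (`twR_pairField_eq_sum_bondPair`);
* for `L ≥ 3`, `A_d(x,y) = ω_d(y - x)` unless the torus and box adjacencies of `(x,y)` disagree
  (`twR_pairWeight_eq_of_adj_iff`), whence (`≤ 4L` wrap-around pairs, `card_filter_le_of_not_adj_iff`)
  **`‖dWaveSourceTorus L U μ h - H_box‖ ≤ (8 + 96|h|)·L`** (`twR_norm_dWaveSourceTorus_sub_box_le`).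

Ruelle, *Statistical Mechanics: Rigorous Results* (1969) §2.2 (boundary conditions do not matter). [folklore]
-/

set_option linter.dupNamespace false

noncomputable section

namespace Summit.HubbardSuperconductivity.HubbardSuperconductivity.Theorems

open Literature.MathematicalPhysics.QuantumLattice Literature.Barriers.HubbardSuperconductivity
  Literature.Probability.LatticeModels Matrix Finset HubbardWave0 WcbcsBoxTiling Filter
open scoped BigOperators Matrix.Norms.L2Operator Topology

/-! ### The d-wave kernel -/

/-- `ĝ_d(v) ≠ 0` only on the four unit steps. [folklore] -/
theorem twR_mem_unitSteps_of_dWaveFormFactor_ne_zero {v : Site 2} (hv : dWaveFormFactor v ≠ 0) : v ∈ unitSteps := by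
  unfold dWaveFormFactor at hv
  simp only [unitSteps, Finset.mem_insert, Finset.mem_singleton]
  split_ifs at hv with h1 h2
  · tauto
  · tauto
  · exact absurd rfl hv

/-- `‖ω_d(v)‖ ≤ 1` for `ω_d = ĝ_d/√2`. [folklore] -/
theorem twR_dWaveKernel_norm_le (v : Site 2) : ‖(((dWaveFormFactor v / Real.sqrt 2 : ℝ) : ℂ))‖ ≤ 1 := by
  rw [Complex.norm_real, Real.norm_eq_abs, abs_div, abs_of_pos (Real.sqrt_pos.2 two_pos)]
  have h2 : 1 ≤ Real.sqrt 2 := Real.one_le_sqrt.2 (by norm_num)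
  -- `|ĝ_d| ≤ 1` (the tree's `abs_dWaveFormFactor_le_one`, inlined to keep the import cone small)
  have hd : |dWaveFormFactor v| ≤ 1 := by
    unfold dWaveFormFactor
    split_ifs <;> simp
  calc |dWaveFormFactor v| / Real.sqrt 2 ≤ |dWaveFormFactor v| / 1 :=
        div_le_div_of_nonneg_left (abs_nonneg _) one_pos h2
    _ ≤ 1 := by rw [div_one]; exact hd

/-- Unit steps of `ℤ²` are nearest-neighbour displacements. [folklore] -/
theorem twR_zdGraph_adj_of_sub_mem_unitSteps {a b : Site 2} (h : b - a ∈ unitSteps) : (zdGraph 2).Adj a b := by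
  rw [zdGraph_adj_iff]
  simp only [unitSteps, Finset.mem_insert, Finset.mem_singleton] at h
  rcases h with h | h | h | h
  · exact ⟨0, Or.inl (by rw [← h]; abel)⟩
  · exact ⟨0, Or.inr (by rw [show a = b - (b - a) by abel, h]; abel)⟩
  · exact ⟨1, Or.inl (by rw [← h]; abel)⟩
  · exact ⟨1, Or.inr (by rw [show a = b - (b - a) by abel, h]; abel)⟩

/-- `ω_d(b - a) ≠ 0 → a ∼ b` in `ℤ²`. [folklore] -/
theorem twR_dWaveKernel_adj (a b : Site 2) (h : (((dWaveFormFactor (b - a) / Real.sqrt 2 : ℝ) : ℂ)) ≠ 0) :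
    (zdGraph 2).Adj a b := by
  refine twR_zdGraph_adj_of_sub_mem_unitSteps (twR_mem_unitSteps_of_dWaveFormFactor_ne_zero fun h0 => h ?_)
  rw [h0, zero_div, Complex.ofReal_zero]

/-- `ω_d` as a sum over the unit steps: `ω_d(v) = Σ_{e ∈ unitSteps} 1[v = e] ĝ_d(e)/√2`. [folklore] -/
theorem twR_dWaveKernel_eq_sum (v : Site 2) :
    (((dWaveFormFactor v / Real.sqrt 2 : ℝ) : ℂ)) =
      ∑ e ∈ unitSteps, (if v = e then ((dWaveFormFactor e / Real.sqrt 2 : ℝ) : ℂ) else 0) := by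
  rw [Finset.sum_ite_eq]
  split_ifs with hv
  · rfl
  · have h0 : dWaveFormFactor v = 0 := by
      by_contra hne
      exact hv (twR_mem_unitSteps_of_dWaveFormFactor_ne_zero hne)
    rw [h0, zero_div, Complex.ofReal_zero]

/-! ### The free-boundary box on the torus vertex set is the `L × L` rectangle -/

section Box

variable (L : ℕ)

/-- **`Z_β(H_box) = Z_β(L × L rectangle)`** with the d-wave kernel: `x ↦ (x₀, x₁)` is a graph isomorphism carrying the
box weights to the rectangle weights (tree `relabel`, `twR_partitionFn_sourced_relabel`). [folklore] -/
theorem twR_box_partitionFn_eq_rect (β U μ h : ℝ) :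
    partitionFn β (hamiltonianWith ((zdGraph 2).comap (fun x : FermionTorus 2 L => fun i : Fin 2 => ((ofLex x i : ℕ) : ℤ))) 1 U μ - (h : ℂ) • ((∑ z : FermionTorus 2 L × FermionTorus 2 L, (fun z : FermionTorus 2 L × FermionTorus 2 L => (((dWaveFormFactor ((fun i : Fin 2 => ((ofLex z.2 i : ℕ) : ℤ)) - (fun i : Fin 2 => ((ofLex z.1 i : ℕ) : ℤ))) / Real.sqrt 2 : ℝ) : ℂ))) z • bondPair z.1 z.2) + (∑ z : FermionTorus 2 L × FermionTorus 2 L, (fun z : FermionTorus 2 L × FermionTorus 2 L => (((dWaveFormFactor ((fun i : Fin 2 => ((ofLex z.2 i : ℕ) : ℤ)) - (fun i : Fin 2 => ((ofLex z.1 i : ℕ) : ℤ))) / Real.sqrt 2 : ℝ) : ℂ))) z • bondPair z.1 z.2)ᴴ)) = partitionFn β (hamiltonianWith ((zdGraph 2).comap (fun p : (Lex (Fin L × Fin L)) => ![((ofLex p).1 : ℤ), ((ofLex p).2 : ℤ)])) 1 U μ - (h : ℂ) • ((∑ z : (Lex (Fin L × Fin L)) × (Lex (Fin L × Fin L)), (fun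 z : (Lex (Fin L × Fin L)) × (Lex (Fin L × Fin L)) => (fun v : Fin 2 → ℤ => ((dWaveFormFactor v / Real.sqrt 2 : ℝ) : ℂ)) (![((ofLex z.2).1 : ℤ), ((ofLex z.2).2 : ℤ)] - ![((ofLex z.1).1 : ℤ), ((ofLex z.1).2 : ℤ)])) z • bondPair z.1 z.2) + (∑ z : (Lex (Fin L × Fin L)) × (Lex (Fin L × Fin L)), (fun z : (Lex (Fin L × Fin L)) × (Lex (Fin L × Fin L)) => (fun v : Fin 2 → ℤ => ((dWaveFormFactor v / Real.sqrt 2 : ℝ) : ℂ)) (![((ofLex z.2).1 : ℤ), ((ofLex z.2).2 : ℤ)] - ![((ofLex z.1).1 : ℤ), ((ofLex z.1).2 : ℤ)])) z • bondPair z.1 z.2)ᴴ)) := by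
  have key : ∀ z : (Lex (Fin L × Fin L)),
      (fun i : Fin 2 => ((ofLex ((ofLex.trans (((finTwoArrowEquiv (Fin L)).symm).trans toLex)) z) i : ℕ) : ℤ)) =
        ![((ofLex z).1 : ℤ), ((ofLex z).2 : ℤ)] := by
    intro z
    funext i
    fin_cases i <;> rfl
  -- (the synthesised `DecidableEq`/`DecidableRel` instances of the statement differ from the ones carried by the
  -- general lemma only up to `Subsingleton.elim`: `convert`)
  have hmain := twR_partitionFn_sourced_relabel ((zdGraph 2).comap (fun p : (Lex (Fin L × Fin L)) => ![((ofLex p).1 : ℤ), ((ofLex p).2 : ℤ)])) ((zdGraph 2).comap (fun x : FermionTorus 2 L => fun i : Fin 2 => ((ofLex x i : ℕ) : ℤ))) (ofLex.trans (((finTwoArrowEquiv (Fin L)).symm).trans toLex))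
    (fun x y => by rw [SimpleGraph.comap_adj, SimpleGraph.comap_adj, key, key]) β 1 U μ h (fun z : (Lex (Fin L × Fin L)) × (Lex (Fin L × Fin L)) => (fun v : Fin 2 → ℤ => ((dWaveFormFactor v / Real.sqrt 2 : ℝ) : ℂ)) (![((ofLex z.2).1 : ℤ), ((ofLex z.2).2 : ℤ)] - ![((ofLex z.1).1 : ℤ), ((ofLex z.1).2 : ℤ)])) (fun z : FermionTorus 2 L × FermionTorus 2 L => (((dWaveFormFactor ((fun i : Fin 2 => ((ofLex z.2 i : ℕ) : ℤ)) - (fun i : Fin 2 => ((ofLex z.1 i : ℕ) : ℤ))) / Real.sqrt 2 : ℝ) : ℂ))) (fun x y => by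
      show (((dWaveFormFactor ((fun i : Fin 2 => ((ofLex ((ofLex.trans (((finTwoArrowEquiv (Fin L)).symm).trans toLex)) y) i : ℕ) : ℤ)) -
        (fun i : Fin 2 => ((ofLex ((ofLex.trans (((finTwoArrowEquiv (Fin L)).symm).trans toLex)) x) i : ℕ) : ℤ))) / Real.sqrt 2 : ℝ) : ℂ)) = _
      rw [key, key])
  convert hmain using 2

end Box

/-! ### The hopping parts: torus versus box -/

section Hopping

variable {L : ℕ}

/-- Double sums over bonds `(x, y, σ)` of spin-independent terms are twice the sums over ordered pairs. [folklore] -/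
theorem twR_sum_bond_eq_two_mul {Λ : Type*} [Fintype Λ] (F : Λ → Λ → ℝ) :
    ∑ b : Bond Λ, F b.1 b.2.1 = 2 * ∑ z : Λ × Λ, F z.1 z.2 := by
  rw [Fintype.sum_prod_type, Fintype.sum_prod_type (f := fun z : Λ × Λ => F z.1 z.2), Finset.mul_sum]
  refine Finset.sum_congr rfl fun x _ => ?_
  rw [Fintype.sum_prod_type, Finset.mul_sum]
  refine Finset.sum_congr rfl fun y _ => ?_
  rw [Fin.sum_univ_two]
  ring

/-- **Hopping mismatch**: on `FermionTorus 2 L`, `‖(H(1,U)-μN)_torus - (H(1,U)-μN)_box‖ ≤ 8L` (the couplings differ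
on the `≤ 4L` wrap-around ordered pairs, two spins, `‖c†c‖ ≤ 1`). [folklore] -/
theorem twR_norm_hamiltonianWith_torus_sub_box_le (U μ : ℝ) :
    ‖hamiltonianWith (fermionTorusGraph 2 L) 1 U μ - hamiltonianWith ((zdGraph 2).comap (fun x : FermionTorus 2 L => fun i : Fin 2 => ((ofLex x i : ℕ) : ℤ))) 1 U μ‖ ≤ 8 * L := by
  rw [twR_hamiltonianWith_eq_onSiteSum_sub_hopSum, twR_hamiltonianWith_eq_onSiteSum_sub_hopSum, sub_sub_sub_cancel_left]
  have hdiff : hopSum (hubbardCoupling ((zdGraph 2).comap (fun x : FermionTorus 2 L => fun i : Fin 2 => ((ofLex x i : ℕ) : ℤ))) ((1 : ℝ) : ℂ)) - hopSum (hubbardCoupling (fermionTorusGraph 2 L) ((1 : ℝ) : ℂ)) =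
      ∑ b : Bond (FermionTorus 2 L), (hubbardCoupling ((zdGraph 2).comap (fun x : FermionTorus 2 L => fun i : Fin 2 => ((ofLex x i : ℕ) : ℤ))) ((1 : ℝ) : ℂ) b - hubbardCoupling (fermionTorusGraph 2 L) ((1 : ℝ) : ℂ) b) • bondOp b := by
    simp only [hopSum, sub_smul, Finset.sum_sub_distrib]
  rw [hdiff]
  have h1 := twR_norm_sum_smul_le Finset.univ
    (fun b => hubbardCoupling ((zdGraph 2).comap (fun x : FermionTorus 2 L => fun i : Fin 2 => ((ofLex x i : ℕ) : ℤ))) ((1 : ℝ) : ℂ) b - hubbardCoupling (fermionTorusGraph 2 L) ((1 : ℝ) : ℂ) b) (fun b => bondOp b) (B := 1)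
    (fun b _ => twR_norm_bondOp_le b)
  rw [one_mul] at h1
  refine h1.trans ?_
  -- each coupling difference is bounded by the mismatch indicator
  have hPQ : ∀ (P Q : Prop) [Decidable P] [Decidable Q],
      ‖(if Q then (((1 : ℝ) : ℂ)) else 0) - (if P then (((1 : ℝ) : ℂ)) else 0)‖ ≤ (if ¬ (P ↔ Q) then (1 : ℝ) else 0) := by
    intro P Q _ _
    by_cases hP : P <;> by_cases hQ : Q <;> simp [hP, hQ]
  have hle : ∀ b : Bond (FermionTorus 2 L), ‖hubbardCoupling ((zdGraph 2).comap (fun x : FermionTorus 2 L => fun i : Fin 2 => ((ofLex x i : ℕ) : ℤ))) ((1 : ℝ) : ℂ) b - hubbardCoupling (fermionTorusGraph 2 L) ((1 : ℝ) : ℂ) b‖ ≤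
      (if ¬ ((fermionTorusGraph 2 L).Adj b.1 b.2.1 ↔ ((zdGraph 2).comap (fun x : FermionTorus 2 L => fun i : Fin 2 => ((ofLex x i : ℕ) : ℤ))).Adj b.1 b.2.1) then (1 : ℝ) else 0) := fun b => by
    rw [hubbardCoupling_apply, hubbardCoupling_apply]
    exact hPQ _ _
  calc ∑ b : Bond (FermionTorus 2 L), ‖hubbardCoupling ((zdGraph 2).comap (fun x : FermionTorus 2 L => fun i : Fin 2 => ((ofLex x i : ℕ) : ℤ))) ((1 : ℝ) : ℂ) b - hubbardCoupling (fermionTorusGraph 2 L) ((1 : ℝ) : ℂ) b‖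
      ≤ ∑ b : Bond (FermionTorus 2 L), (if ¬ ((fermionTorusGraph 2 L).Adj b.1 b.2.1 ↔ ((zdGraph 2).comap (fun x : FermionTorus 2 L => fun i : Fin 2 => ((ofLex x i : ℕ) : ℤ))).Adj b.1 b.2.1) then (1 : ℝ) else 0) :=
        Finset.sum_le_sum fun b _ => hle b
    _ = 2 * ∑ z : FermionTorus 2 L × FermionTorus 2 L, (if ¬ ((fermionTorusGraph 2 L).Adj z.1 z.2 ↔ ((zdGraph 2).comap (fun x : FermionTorus 2 L => fun i : Fin 2 => ((ofLex x i : ℕ) : ℤ))).Adj z.1 z.2) then (1 : ℝ) else 0) :=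
        twR_sum_bond_eq_two_mul (fun x y => if ¬ ((fermionTorusGraph 2 L).Adj x y ↔ ((zdGraph 2).comap (fun x : FermionTorus 2 L => fun i : Fin 2 => ((ofLex x i : ℕ) : ℤ))).Adj x y) then (1 : ℝ) else 0)
    _ = 2 * (((Finset.univ : Finset (FermionTorus 2 L × FermionTorus 2 L)).filter
          (fun z => ¬ ((fermionTorusGraph 2 L).Adj z.1 z.2 ↔ ((zdGraph 2).comap (fun x : FermionTorus 2 L => fun i : Fin 2 => ((ofLex x i : ℕ) : ℤ))).Adj z.1 z.2))).card : ℝ) := by rw [Finset.sum_boole]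
    _ ≤ 2 * (4 * L : ℕ) := by
        gcongr
        exact_mod_cast card_filter_le_of_not_adj_iff (fun z : FermionTorus 2 L × FermionTorus 2 L => ¬ ((fermionTorusGraph 2 L).Adj z.1 z.2 ↔ ((zdGraph 2).comap (fun x : FermionTorus 2 L => fun i : Fin 2 => ((ofLex x i : ℕ) : ℤ))).Adj z.1 z.2))
          (fun z hz => hz)
    _ = 8 * L := by push_cast; ring

end Hopping

/-! ### The pair field as a sum over ordered site pairs -/

section PairField

variable (g : Site 2 → ℝ) (L : ℕ) [NeZero L]

/-- **`Δ_g = Σ_{(x,y)} A_g(x,y) b_{xy}`** with `A_g(x,y) = Σ_{e ∈ {0,±e₁,±e₂}} 1[y = x + e on the torus] g(e)/√2`. [folklore] -/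
theorem twR_pairField_eq_sum_bondPair :
    pairField g L = ∑ z : FermionTorus 2 L × FermionTorus 2 L, (fun z : FermionTorus 2 L × FermionTorus 2 L => ∑ e ∈ insert (0 : Site 2) unitSteps, (if FermionTorus.ofTorusSite (FermionTorus.toTorusSite z.1 + Torus.proj L e) = z.2 then ((g e / Real.sqrt 2 : ℝ) : ℂ) else 0)) z • bondPair z.1 z.2 := by
  rw [pairField, Fintype.sum_prod_type]
  rw [← (FermionTorus.equivTorusSite (d := 2) (L := L)).sum_comp]
  refine Finset.sum_congr rfl fun x _ => ?_
  show localPair g L (FermionTorus.toTorusSite x) = _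
  rw [localPair_eq_sum_bondPair, FermionTorus.ofTorusSite_toTorusSite]
  -- insert the Kronecker delta in `y` and exchange the sums
  have hδ : ∀ e : Site 2, ((g e / Real.sqrt 2 : ℝ) : ℂ) • bondPair x (FermionTorus.ofTorusSite (FermionTorus.toTorusSite x + Torus.proj L e)) =
      ∑ y : FermionTorus 2 L, (if FermionTorus.ofTorusSite (FermionTorus.toTorusSite x + Torus.proj L e) = y
        then ((g e / Real.sqrt 2 : ℝ) : ℂ) else 0) • bondPair x y := by
    intro e
    simp only [ite_smul, zero_smul, Finset.sum_ite_eq, Finset.mem_univ, if_true]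
  simp_rw [hδ]
  rw [Finset.sum_comm]
  refine Finset.sum_congr rfl fun y _ => ?_
  rw [Finset.sum_smul]

/-- `‖A_d(x,y)‖ ≤ 5` for the d-wave form factor. [folklore] -/
theorem twR_norm_pairWeight_le (z : FermionTorus 2 L × FermionTorus 2 L) : ‖(fun z : FermionTorus 2 L × FermionTorus 2 L => ∑ e ∈ insert (0 : Site 2) unitSteps, (if FermionTorus.ofTorusSite (FermionTorus.toTorusSite z.1 + Torus.proj L e) = z.2 then ((dWaveFormFactor e / Real.sqrt 2 : ℝ) : ℂ) else 0)) z‖ ≤ 5 := by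
  refine (norm_sum_le _ _).trans ?_
  calc ∑ e ∈ insert (0 : Site 2) unitSteps, ‖(if FermionTorus.ofTorusSite (FermionTorus.toTorusSite z.1 + Torus.proj L e) = z.2
          then ((dWaveFormFactor e / Real.sqrt 2 : ℝ) : ℂ) else 0)‖
      ≤ ∑ _e ∈ insert (0 : Site 2) unitSteps, (1 : ℝ) := Finset.sum_le_sum fun e _ => by
          split_ifs
          · exact twR_dWaveKernel_norm_le e
          · rw [norm_zero]; exact zero_le_one
    _ ≤ 5 := by
        rw [Finset.sum_const, nsmul_eq_mul, mul_one]
        have h4 : (unitSteps).card ≤ 4 := Finset.card_le_four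
        have h5 := (Finset.card_insert_le (0 : Site 2) unitSteps).trans (Nat.succ_le_succ h4)
        exact_mod_cast h5

end PairField

/-! ### Summary (registered sub-goal of stmt-HubbardSuperconductivity-15581) -/

/-- **Registered sub-goal `twR_torusBoxHopping`** (infrastructure for `stub_sourcedPressureLimit`): the hopping parts of
the periodic and free-boundary Hubbard Hamiltonians on `FermionTorus 2 L` differ by at most `8L` in operator norm. [folklore] -/
theorem twR_torusBoxHopping : ∀ (L : ℕ) (U μ : ℝ), ‖hamiltonianWith (fermionTorusGraph 2 L) 1 U μ - hamiltonianWith ((Literature.Probability.LatticeModels.zdGraph 2).comap (fun x : FermionTorus 2 L => fun i : Fin 2 => ((ofLex x i : ℕ) : ℤ))) 1 U μ‖ ≤ 8 * L :=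
  fun _ U μ => twR_norm_hamiltonianWith_torus_sub_box_le U μ

end Summit.HubbardSuperconductivity.HubbardSuperconductivity.Theorems

end
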